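import Summits.Ventures.CertifiedArithmetic.LowPrec.GemmFirstRegimeLow
import HarnessLib

/-!
# GEMM worst case LXIII-b — THE EXACT LAW OF THE FIRST REGIME, every grid alphabet and
# precision: `R(x, n₀ + k) ≤ max(k/(B+k), (k-1)/(T+k-1))`

HONEST FRAMING: certified error envelopes and provably optimal rounding/accumulation schemes for
low-precision formats under stated cost models; every table by two implementations; no hardware or
vendor claims.

Setting of files LXII-a/LXIII-a (`GemmFirstRegimeGrid`, `GemmFirstRegimeLow`): letters
`x j = z_j/2^G`, `|z_j| ≤ M`, `z_j` odd only when `|z_j| ≤ m₀`; `T = 2^(manBits φ + 1)`; exact prefix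
of `n₀ = j₀ + 1` letters (`M j₀ + m₀ < T`); `Q = 2T - M(n₀+1) ≥ 1`; ENTRY-MASS hypothesis `hB`
(an odd `(n₀+1)`-letter sum `> T` has mass `≥ B + 1`).  THE UPPER HALF OF THE LAW
(gemm.tex Prop. p:fpL; the lower half is the entry/late families of file LX,
`le_gridW_entry`/`le_gridW_late`):

  `R(x, n₀ + k) ≤ max(k/(B+k), (k-1)/(T+k-1))`  for every word and every `k = d + 1` with
  (H1) `2T(M+1) + Q(M+2d) ≤ QT + M(M+1)`, i.e. `k ≲ T/2 - (M+1)(1 + T/Q)` — all of the first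
  regime `k ≤ T/2` but a top sliver of width `≈ 1.5 M` (there the law is open).

* LOW words (every `ŝ + x` below `2T` in grid units): file LXIII-a, `relErr_le_of_lowInvG`.
* HIGH words (`relErr_le_firstRegimeLaw`, this file): let `a` be the first index with
  `|ŝ_a + x_{a+1}| ≥ 2T/2^G`; `a = n₀ + t ≥ n₀` because `M(n₀+1) < 2T`.  Up to `a` the word is low,
  so (`LowInvG`) `|ŝ_a - s_a| ≤ N₁/2^G` with `N₁ ≤ t + 1`, while `|ŝ_a| ≥ (2T-M)/2^G`; hence the mass
  `L_a ≥ |ŝ_a| - N₁/2^G` and, as `L_a ≤ M(a+1)/2^G`, `Q ≤ M(t+1) + N₁`.  RESTART at `a`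
  (`restartW`: the word `ŝ_a, x_{a+1}, …` has the same accumulations) and bound the remaining
  `r = d - t` roundings twice: by Lange–Rump [LangeRump2019; BoldoEtAl2023, Thm 4.5],
  `E₂ ≤ r/(T+r) · (|ŝ_a| + X)`, and trivially `E₂ ≤ X` (`abs_seqSum_sub_sum_le_tail`), `X` the
  restarted mass.  The convex combination with weight `λ = t/(T+d)` of the two bounds
  (`firstRegime_high_alg`) leaves exactly the condition `N₁(T+2d) ≤ t(2T-M)`, which integer
  arithmetic (`firstRegime_hc`) derives from `N₁ ≤ t+1`, `Q ≤ M(t+1)+N₁` and (H1).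

References: [Higham2002, §4.2], [IEEE7542019, §4.3.1], [LangeRump2019], [BoldoEtAl2023, Thm 4.5],
[RouhaniEtAl2023MX, Table 1] (the alphabets this is instantiated to in file LXIII-c).
-/

namespace Summit.Ventures.CertifiedArithmetic.LowPrec.Gemm

open Literature.ComputerArithmetic.FloatingPoint
open Literature.ComputerArithmetic.FloatingPoint.MiniFloat
open Literature.ComputerArithmetic.JeannerodRump2018
open Finset

variable {φ : Format}

/-! ### Restarting a recursive summation at an accumulator -/

/-- The word restarted at `a`: `ŝ_a, x_{a+1}, x_{a+2}, …`. [cell] -/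
def restartW (φ : Format) (x : ℕ → ℚ) (a : ℕ) : ℕ → ℚ :=
  fun i => if i = 0 then (seqSum φ x a).toRat else x (a + i)

/-- The restarted word starts with the accumulator `ŝ_a`. [cell] -/
@[simp] theorem restartW_zero (x : ℕ → ℚ) (a : ℕ) :
    restartW φ x a 0 = (seqSum φ x a).toRat := rfl

/-- … and continues with the letters `x_{a+1+i}`. [cell] -/
@[simp] theorem restartW_succ (x : ℕ → ℚ) (a i : ℕ) :
    restartW φ x a (i + 1) = x (a + 1 + i) := by
  simp [restartW, show a + (i + 1) = a + 1 + i by ring]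

/-- Restarting changes no accumulator: `ŝ_{a+i}(x) = ŝ_i(restartW x a)` (the accumulator is a
value of `φ`, `toRat_roundNE_toRat`). [folklore] -/
theorem toRat_seqSum_restartW (x : ℕ → ℚ) (a : ℕ) :
    ∀ i, (seqSum φ x (a + i)).toRat = (seqSum φ (restartW φ x a) i).toRat
  | 0 => by simp [seqSum, toRat_roundNE_toRat]
  | i + 1 => by
      have ih := toRat_seqSum_restartW x a i
      have e : a + 1 + i = a + i + 1 := by ring
      show (roundNE φ ((seqSum φ x (a + i)).toRat + x (a + i + 1))).toRat
        = (roundNE φ ((seqSum φ (restartW φ x a) i).toRat + restartW φ x a (i + 1))).toRat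
      rw [ih, restartW_succ, e]

/-- `Σ_{i≤r} (restartW x a) i = ŝ_a + Σ_{i<r} x_{a+1+i}`. [cell] -/
theorem sum_restartW (x : ℕ → ℚ) (a r : ℕ) : ∑ i ∈ range (r + 1), restartW φ x a i
    = (seqSum φ x a).toRat + ∑ i ∈ range r, x (a + 1 + i) := by
  rw [sum_range_succ']; simp only [restartW_succ, restartW_zero]; ring

/-- `Σ_{i≤r} |(restartW x a) i| = |ŝ_a| + Σ_{i<r} |x_{a+1+i}|`. [cell] -/
theorem sum_abs_restartW (x : ℕ → ℚ) (a r : ℕ) : ∑ i ∈ range (r + 1), |restartW φ x a i|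
    = |(seqSum φ x a).toRat| + ∑ i ∈ range r, |x (a + 1 + i)| := by
  rw [sum_range_succ']; simp only [restartW_succ, restartW_zero]; ring

/-! ### Arithmetic of the high words -/

/-- (H1) forces `T ≥ M + 2d + 1` and `Q ≥ 1`. [cell] -/
theorem firstRegime_H1_facts {T M Q d : ℕ} (hM : 1 ≤ M) (hMT : M ≤ T)
    (H1 : 2 * T * (M + 1) + Q * (M + 2 * d) ≤ Q * T + M * (M + 1)) :
    M + 2 * d + 1 ≤ T ∧ 1 ≤ Q := by
  have key : ¬ 2 * T * (M + 1) ≤ M * (M + 1) := by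
    intro h
    have := Nat.le_of_mul_le_mul_right h (by omega)
    omega
  constructor
  · by_contra h
    have h' : T ≤ M + 2 * d := by omega
    have h1 : Q * T ≤ Q * (M + 2 * d) := Nat.mul_le_mul_left _ h'
    exact key (by linarith)
  · by_contra h
    have h0 : Q = 0 := by omega
    subst h0
    exact key (by simpa using H1)

/-- THE COUNTING STEP: `N₁ ≤ t+1`, `Q ≤ M(t+1) + N₁` and (H1) give `N₁(T+2d) ≤ t(2T-M)`.
[cell, gemm.tex Prop. p:fpL] -/
theorem firstRegime_hc {T M Q N1 t d : ℕ} (hM : 1 ≤ M) (hMT : M ≤ T) (hN1 : N1 ≤ t + 1)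
    (hQ : Q ≤ M * (t + 1) + N1)
    (H1 : 2 * T * (M + 1) + Q * (M + 2 * d) ≤ Q * T + M * (M + 1)) :
    N1 * (T + 2 * d) + t * M ≤ 2 * T * t := by
  obtain ⟨hdT, hQ1⟩ := firstRegime_H1_facts hM hMT H1
  obtain ⟨s, rfl⟩ : ∃ s, T = M + 2 * d + 1 + s := ⟨T - (M + 2 * d + 1), by omega⟩
  by_cases hc : Q ≤ N1 * (M + 1)
  · -- many errors: `t ≥ N₁ - 1` and (H1) ⇒ `N₁ (T - M - 2d) ≥ 2T - M`
    have h3 : Q * (1 + s) ≤ N1 * (M + 1) * (1 + s) := Nat.mul_le_mul_right _ hc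
    have h4 : 2 * (M + 2 * d + 1 + s) * (M + 1) ≤ (N1 * (1 + s) + M) * (M + 1) := by nlinarith
    have h5 : 2 * (M + 2 * d + 1 + s) ≤ N1 * (1 + s) + M :=
      Nat.le_of_mul_le_mul_right h4 (by omega)
    have hN1pos : 1 ≤ N1 := by
      by_contra h
      have h0 : N1 = 0 := by omega
      subst h0
      simp at hc
      omega
    obtain ⟨N, rfl⟩ : ∃ N, N1 = N + 1 := ⟨N1 - 1, by omega⟩
    have hNt : N ≤ t := by omega
    have h6 := Nat.mul_le_mul_right (M + 4 * d + 2 + 2 * s) hNt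
    nlinarith
  · -- few errors: then `N₁ ≤ t`, and `T + 2d ≤ 2T - M`
    have hc' : N1 * (M + 1) < Q := not_le.mp hc
    have h3 : M * N1 < M * (t + 1) := by nlinarith
    have h4 : N1 ≤ t := Nat.lt_succ_iff.mp (Nat.lt_of_mul_lt_mul_left h3)
    have h5 := Nat.mul_le_mul_right (M + 4 * d + 1 + s) h4
    have h6 := Nat.zero_le (t + t * s)
    nlinarith

/-- THE CONVEX-COMBINATION STEP (weight `λ = t/(T+d)` on the trivial bound `E₂ ≤ X`, `1-λ` on the
Lange–Rump bound): the two bounds on the restarted error, the mass `L_a ≥ |ŝ_a| - e₁` and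
`e₁(T+2d) ≤ t|ŝ_a|` give `e₁ + E₂ ≤ d/(T+d) · (L_a + X)`. [cell, gemm.tex Prop. p:fpL] -/
theorem firstRegime_high_alg {T t d e1 E2 X S La : ℚ} (hT : 0 < T) (ht : 0 ≤ t) (htd : t ≤ d)
    (hE2X : E2 ≤ X) (hE2r : E2 ≤ (d - t) / (T + (d - t)) * (S + X)) (hLa : S - e1 ≤ La)
    (hc : e1 * (T + 2 * d) ≤ t * S) : e1 + E2 ≤ d / (T + d) * (La + X) := by
  have hd : 0 ≤ d := le_trans ht htd
  have hTd : 0 < T + d := by linarith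
  have hTdt : 0 < T + (d - t) := by linarith
  have h1 : E2 * (T + (d - t)) ≤ (d - t) * (S + X) := by
    have h := hE2r
    rw [div_mul_eq_mul_div, le_div_iff₀ hTdt] at h
    exact h
  have h2 : E2 * (T + d) ≤ d * X + (d - t) * S := by
    nlinarith [mul_le_mul_of_nonneg_left hE2X ht]
  rw [div_mul_eq_mul_div, le_div_iff₀ hTd]
  nlinarith [mul_le_mul_of_nonneg_left hLa hd]

section Grid

variable {G M m0 E : ℕ} {x : ℕ → ℚ}
  (hx : ∀ j, ∃ z : ℤ, x j = (z : ℚ) / 2 ^ G ∧ z.natAbs ≤ M ∧ (z % 2 = 0 ∨ z.natAbs ≤ m0))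
  (hq : φ.qexp ≤ -(G : ℤ)) (hR : (2 : ℚ) ^ (φ.manBits + E + 3) ≤ φ.maxRat)
  (hm0M : m0 ≤ M) (hMT : M ≤ 2 ^ (φ.manBits + 1)) (hm0 : 1 ≤ m0) (hME : M ≤ 2 ^ (G + E))
include hx hq hR hm0M hMT hm0 hME

/-- THE EXACT LAW OF THE FIRST REGIME, upper half, every grid alphabet and precision: under the
entry-mass hypothesis `hB` (`B + 1 = A*`) and (H1) (`k = d+1 ≲ T/2 - 1.5M`),
`R(x, j₀+1+d) ≤ max((d+1)/(B+d+1), d/(T+d))` for EVERY word. [cell, gemm.tex Prop. p:fpL;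
cite: LangeRump2019; BoldoEtAl2023, Thm 4.5] -/
theorem relErr_le_firstRegimeLaw {j0 Bn Q d : ℕ} (hj0 : M * j0 + m0 < 2 ^ (φ.manBits + 1))
    (hB : (∑ i ∈ range (j0 + 2), zl G x i) % 2 ≠ 0 →
      2 ^ (φ.manBits + 1) < (∑ i ∈ range (j0 + 2), zl G x i).natAbs →
      ((Bn : ℚ) + 1) / 2 ^ G ≤ ∑ i ∈ range (j0 + 2), |x i|)
    (hQ : M * (j0 + 2) + Q = 2 * 2 ^ (φ.manBits + 1))
    (H1 : 2 * 2 ^ (φ.manBits + 1) * (M + 1) + Q * (M + 2 * d)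
      ≤ Q * 2 ^ (φ.manBits + 1) + M * (M + 1)) :
    relErr φ x (j0 + 1 + d) ≤ max (((d + 1 : ℕ) : ℚ) / ((Bn : ℚ) + ((d + 1 : ℕ) : ℚ)))
      ((d : ℚ) / (2 ^ (φ.manBits + 1) + d)) := by
  classical
  have hGpos : (0 : ℚ) < 2 ^ G := by positivity
  have hM1 : 1 ≤ M := le_trans hm0 hm0M
  obtain ⟨hdT, hQ1⟩ := firstRegime_H1_facts (d := d) hM1 hMT H1
  have hT2 : (2 : ℚ) ^ (φ.manBits + 2) = 2 * 2 ^ (φ.manBits + 1) := by ring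
  have hTpos : (0 : ℚ) < 2 ^ (φ.manBits + 1) := by positivity
  have hMq : (M : ℚ) ≤ 2 ^ (φ.manBits + 1) := by exact_mod_cast hMT
  have hdTq : (M : ℚ) + 2 * d + 1 ≤ 2 ^ (φ.manBits + 1) := by exact_mod_cast hdT
  have hmax0 : 0 ≤ max (((d + 1 : ℕ) : ℚ) / ((Bn : ℚ) + ((d + 1 : ℕ) : ℚ)))
      ((d : ℚ) / (2 ^ (φ.manBits + 1) + d)) :=
    le_trans (by positivity) (le_max_right _ _)
  -- a letter has modulus `≤ M/2^G`
  have hxle : ∀ i, |x i| ≤ (M : ℚ) / 2 ^ G := by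
    intro i
    obtain ⟨z, hz, hzM, -⟩ := hx i
    rw [hz, abs_div, abs_of_pos hGpos, ← Int.cast_abs, Int.abs_eq_natAbs, Int.cast_natCast]
    exact div_le_div_of_nonneg_right (by exact_mod_cast hzM) hGpos.le
  -- EITHER the word is low up to `j₀ + d` …
  by_cases hex : ∃ j, j0 ≤ j ∧ j < j0 + (d + 1) ∧
      2 ^ (φ.manBits + 2) / 2 ^ G ≤ |(seqSum φ x j).toRat + x (j + 1)|
  swap
  · have hall : ∀ j, j0 ≤ j → j < j0 + (d + 1) →
        |(seqSum φ x j).toRat + x (j + 1)| < 2 ^ (φ.manBits + 2) / 2 ^ G :=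
      fun j h1 h2 => lt_of_not_ge fun h => hex ⟨j, h1, h2, h⟩
    have h := lowInvG_of_low hx hq hR hm0M hMT hj0 hB (d + 1) hall
    rw [show j0 + (d + 1) = j0 + 1 + d by ring] at h
    exact relErr_le_of_lowInvG h
  -- … OR it has a first high step `a = j₀ + 1 + t`
  obtain ⟨a, hja, hlt, hbig, hmin⟩ : ∃ a, j0 ≤ a ∧ a < j0 + (d + 1) ∧
      2 ^ (φ.manBits + 2) / 2 ^ G ≤ |(seqSum φ x a).toRat + x (a + 1)| ∧
      ∀ j, j0 ≤ j → j < a →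
        |(seqSum φ x j).toRat + x (j + 1)| < 2 ^ (φ.manBits + 2) / 2 ^ G := by
    obtain ⟨hja, hlt, hbig⟩ := Nat.find_spec hex
    exact ⟨Nat.find hex, hja, hlt, hbig, fun j h1 h2 =>
      lt_of_not_ge fun h => Nat.find_min hex h2 ⟨h1, by omega, h⟩⟩
  have ha0 : a ≠ j0 := by
    intro h
    have hb := hbig
    rw [h, seqSum_exact_prefixG hx hq hR hm0M hMT hj0 j0 le_rfl, ← sum_range_succ x (j0 + 1)]
      at hb
    have h1 : |∑ i ∈ range (j0 + 2), x i| ≤ ∑ i ∈ range (j0 + 2), |x i| :=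
      abs_sum_le_sum_abs _ _
    have h2 := sum_abs_leG hx (j0 + 2)
    have h3 : (M : ℚ) / 2 ^ G * ((j0 + 2 : ℕ) : ℚ) < 2 ^ (φ.manBits + 2) / 2 ^ G := by
      rw [div_mul_eq_mul_div, div_lt_div_iff_of_pos_right hGpos, hT2]
      have h4 : M * (j0 + 2) < 2 * 2 ^ (φ.manBits + 1) := by omega
      exact_mod_cast h4
    linarith
  obtain ⟨t, hat⟩ : ∃ t, a = j0 + 1 + t := ⟨a - j0 - 1, by omega⟩
  have htd : t + 1 ≤ d := by omega
  have htq : (t : ℚ) + 1 ≤ d := by exact_mod_cast htd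
  -- the low invariant at `a`
  have hinv : LowInvG φ G Bn (j0 + 1) x a := by
    rw [hat, show j0 + 1 + t = j0 + (t + 1) by ring]
    exact lowInvG_of_low hx hq hR hm0M hMT hj0 hB (t + 1) (fun j h1 h2 => hmin j h1 (by omega))
  obtain ⟨-, hSle, hacc⟩ := hinv
  -- the restart
  set sa := (seqSum φ x a).toRat with hsa
  set Sa := ∑ i ∈ range (a + 1), x i with hSa
  set La := ∑ i ∈ range (a + 1), |x i| with hLa
  set r := d - t with hr
  have hrq : (r : ℚ) = d - t := by rw [hr]; push_cast [Nat.cast_sub (by omega : t ≤ d)]; ring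
  have hn : j0 + 1 + d = a + r := by omega
  have hshift := toRat_seqSum_restartW (φ := φ) x a r
  set w := restartW φ x a with hw
  set X := ∑ i ∈ range r, |x (a + 1 + i)| with hX
  set Px := ∑ i ∈ range r, x (a + 1 + i) with hPx
  have hX0 : 0 ≤ X := sum_nonneg fun i _ => abs_nonneg _
  have hsx : ∑ i ∈ range (a + r + 1), x i = Sa + Px := by
    rw [show a + r + 1 = (a + 1) + r by ring, sum_range_add]
  have hLx : ∑ i ∈ range (a + r + 1), |x i| = La + X := by
    rw [show a + r + 1 = (a + 1) + r by ring, sum_range_add]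
  have hsw : ∑ i ∈ range (r + 1), w i = sa + Px := sum_restartW x a r
  have hLw : ∑ i ∈ range (r + 1), |w i| = |sa| + X := sum_abs_restartW x a r
  -- the two bounds on the restarted error `E₂`
  have hw0 : ∃ y : MiniFloat φ, y.toRat = w 0 := ⟨seqSum φ x a, by rw [hw, restartW_zero]⟩
  have hE2X : |(seqSum φ w r).toRat - (sa + Px)| ≤ X := by
    have h := abs_seqSum_sub_sum_le_tail w hw0 r
    rw [hsw] at h
    refine le_trans h (le_of_eq (sum_congr rfl fun i _ => ?_))
    rw [hw, restartW_succ]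
  have hα : 2 ≤ φ.emaxCode :=
    two_le_emaxCode_of_le (by omega) (le_trans (pow_le_pow_right₀ (by norm_num) (by omega)) hR)
  have hyrep : ∀ i ≤ r, ∃ y : MiniFloat φ, y.toRat = w i := by
    intro i _
    rcases i with _ | i
    · exact hw0
    · rw [hw, restartW_succ]; exact letter_reprG' hx hq hR hMT _
  have hu : φ.unitRoundoff = 1 / 2 ^ (φ.manBits + 1) := Format.unitRoundoff_eq φ
  have hupos := φ.unitRoundoff_pos
  have hrd : (r : ℚ) ≤ d := by rw [hrq]; linarith [(Nat.cast_nonneg t : (0 : ℚ) ≤ t)]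
  have hku : 2 * (r : ℚ) * φ.unitRoundoff ≤ 1 := by
    rw [hu]; field_simp; linarith
  have hx' : ∀ j, ∃ z : ℤ, x (a + 1 + j) = (z : ℚ) / 2 ^ G ∧ z.natAbs ≤ M ∧
      (z % 2 = 0 ∨ z.natAbs ≤ m0) := fun j => hx (a + 1 + j)
  have hXle : X ≤ (M : ℚ) / 2 ^ G * r := sum_abs_leG hx' r
  have hsum : (1 + (r : ℚ) * (φ.unitRoundoff / (1 + φ.unitRoundoff)))
      * ∑ i ∈ range (r + 1), |w i| ≤ φ.maxRat := by
    rw [hLw]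
    have hfac : (r : ℚ) * (φ.unitRoundoff / (1 + φ.unitRoundoff)) ≤ 1 / 2 := by
      have h1 : φ.unitRoundoff / (1 + φ.unitRoundoff) ≤ φ.unitRoundoff :=
        div_le_self hupos.le (by linarith)
      calc (r : ℚ) * (φ.unitRoundoff / (1 + φ.unitRoundoff)) ≤ r * φ.unitRoundoff :=
            mul_le_mul_of_nonneg_left h1 (Nat.cast_nonneg r)
        _ ≤ 1 / 2 := by linarith
    have hMG : (M : ℚ) / 2 ^ G ≤ 2 ^ E := by
      rw [div_le_iff₀ hGpos, ← pow_add, add_comm]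
      exact_mod_cast hME
    have hG1 : (1 : ℚ) ≤ 2 ^ G := one_le_pow₀ (by norm_num)
    have hE1 : (1 : ℚ) ≤ 2 ^ E := one_le_pow₀ (by norm_num)
    have hsa2 : |sa| ≤ 2 * 2 ^ (φ.manBits + 1) := by
      refine le_trans hSle ?_
      rw [div_le_iff₀ hGpos, hT2]
      exact le_mul_of_one_le_right (by positivity) hG1
    have hT1 : (2 : ℚ) ^ (φ.manBits + 1) = 2 * 2 ^ φ.manBits := by ring
    have hr2 : (r : ℚ) ≤ 2 ^ φ.manBits := by linarith [(Nat.cast_nonneg M : (0 : ℚ) ≤ M)]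
    have hX2 : X ≤ 2 ^ E * 2 ^ φ.manBits :=
      le_trans hXle (mul_le_mul hMG hr2 (Nat.cast_nonneg r) (by positivity))
    have e : (2 : ℚ) ^ (φ.manBits + E + 3) = 4 * (2 ^ E * 2 ^ (φ.manBits + 1)) := by ring
    have e2 : (2 : ℚ) ^ E * 2 ^ (φ.manBits + 1) = 2 * (2 ^ E * 2 ^ φ.manBits) := by ring
    have hpos : 0 ≤ |sa| + X := by positivity
    have hET : (2 : ℚ) ^ (φ.manBits + 1) ≤ 2 ^ E * 2 ^ (φ.manBits + 1) :=
      le_mul_of_one_le_left hTpos.le hE1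
    calc (1 + (r : ℚ) * (φ.unitRoundoff / (1 + φ.unitRoundoff))) * (|sa| + X)
        ≤ (3 / 2) * (|sa| + X) := mul_le_mul_of_nonneg_right (by linarith) hpos
      _ ≤ 2 ^ (φ.manBits + E + 3) := by rw [e]; linarith
      _ ≤ φ.maxRat := hR
  have hLR := abs_seqSum_sub_sum_le_langeRump_of_sum_le hα w r hyrep hsum hku
  have hcoef : (r : ℚ) * φ.unitRoundoff / (1 + (r : ℚ) * φ.unitRoundoff)
      = ((d : ℚ) - t) / (2 ^ (φ.manBits + 1) + ((d : ℚ) - t)) := by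
    rw [hu, hrq]; field_simp
  rw [hsw, hLw, hcoef] at hLR
  -- the mass at `a`: `|ŝ_a| ≥ (2T - M)/2^G`, `L_a ≥ |ŝ_a| - e₁`
  have hsabig : (2 * 2 ^ (φ.manBits + 1) - (M : ℚ)) / 2 ^ G ≤ |sa| := by
    have h1 := abs_add_le sa (x (a + 1))
    have h2 := hxle (a + 1)
    rw [hT2] at hbig
    rw [sub_div]
    linarith
  have hsapos : 0 ≤ |sa| := abs_nonneg _
  have hLaS : |sa| - |sa - Sa| ≤ La := by
    have h1 : |Sa| ≤ La := abs_sum_le_sum_abs _ _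
    have h2 := abs_sub_abs_le_abs_sub sa Sa
    linarith
  have hLale : La ≤ (M : ℚ) / 2 ^ G * ((a + 1 : ℕ) : ℚ) := sum_abs_leG hx (a + 1)
  -- the counting condition `e₁ (T + 2d) ≤ t |ŝ_a|`
  have hc : |sa - Sa| * (2 ^ (φ.manBits + 1) + 2 * d) ≤ t * |sa| := by
    rcases hacc with h | ⟨N1, -, hE, hcase⟩
    · have h0 : |sa - Sa| = 0 := by rw [h, sub_self, abs_zero]
      rw [h0, zero_mul]; positivity
    · have hN1 : N1 ≤ t + 1 := by rcases hcase with ⟨-, h⟩ | ⟨-, h⟩ <;> omega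
      have hQle : Q ≤ M * (t + 1) + N1 := by
        have h1 : (2 * 2 ^ (φ.manBits + 1) - (M : ℚ)) / 2 ^ G - N1 / 2 ^ G
            ≤ (M : ℚ) / 2 ^ G * ((a + 1 : ℕ) : ℚ) := by linarith
        rw [← sub_div, div_mul_eq_mul_div, div_le_div_iff_of_pos_right hGpos, hat] at h1
        have h2 : ((M * (j0 + 2) + Q : ℕ) : ℚ) = ((2 * 2 ^ (φ.manBits + 1) : ℕ) : ℚ) := by
          rw [hQ]
        push_cast at h1 h2
        have h3 : (Q : ℚ) ≤ M * (t + 1) + N1 := by linarith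
        exact_mod_cast h3
      have hnat := firstRegime_hc (T := 2 ^ (φ.manBits + 1)) hM1 hMT hN1 hQle H1
      have hq1 : (N1 : ℚ) * (2 ^ (φ.manBits + 1) + 2 * d)
          ≤ t * (2 * 2 ^ (φ.manBits + 1) - M) := by
        have h' : ((N1 * (2 ^ (φ.manBits + 1) + 2 * d) + t * M : ℕ) : ℚ)
            ≤ ((2 * 2 ^ (φ.manBits + 1) * t : ℕ) : ℚ) := by exact_mod_cast hnat
        push_cast at h'
        linarith
      have ht0 : (0 : ℚ) ≤ t := Nat.cast_nonneg t
      calc |sa - Sa| * (2 ^ (φ.manBits + 1) + 2 * d)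
          ≤ (N1 : ℚ) / 2 ^ G * (2 ^ (φ.manBits + 1) + 2 * d) :=
            mul_le_mul_of_nonneg_right hE (by positivity)
        _ = (N1 : ℚ) * (2 ^ (φ.manBits + 1) + 2 * d) / 2 ^ G := by ring
        _ ≤ (t : ℚ) * (2 * 2 ^ (φ.manBits + 1) - M) / 2 ^ G :=
            div_le_div_of_nonneg_right hq1 hGpos.le
        _ = (t : ℚ) * ((2 * 2 ^ (φ.manBits + 1) - M) / 2 ^ G) := by ring
        _ ≤ (t : ℚ) * |sa| := mul_le_mul_of_nonneg_left hsabig ht0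
  -- assemble
  have halg := firstRegime_high_alg (T := 2 ^ (φ.manBits + 1)) (e1 := |sa - Sa|)
    (E2 := |(seqSum φ w r).toRat - (sa + Px)|) (X := X) (S := |sa|) (La := La)
    hTpos (Nat.cast_nonneg t) (by linarith) hE2X hLR hLaS hc
  have hEtot : |(seqSum φ w r).toRat - (Sa + Px)|
      ≤ |sa - Sa| + |(seqSum φ w r).toRat - (sa + Px)| := by
    have h := abs_sub_le (seqSum φ w r).toRat (sa + Px) (Sa + Px)
    rw [show sa + Px - (Sa + Px) = sa - Sa by ring] at h
    linarith
  unfold relErr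
  rw [hn, hshift, hsx, hLx]
  by_cases hL : La + X = 0
  · rw [hL, div_zero]; exact hmax0
  · have hLa0 : 0 ≤ La := by rw [hLa]; exact sum_nonneg fun i _ => abs_nonneg _
    have hLpos : 0 < La + X := lt_of_le_of_ne (add_nonneg hLa0 hX0) (Ne.symm hL)
    refine le_trans ?_ (le_max_right _ _)
    rw [div_le_iff₀ hLpos]
    exact le_trans hEtot halg

end Grid

end Summit.Ventures.CertifiedArithmetic.LowPrec.Gemm
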